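import Summits.QuantumFields.GaugeBoot.Certificates.SparseReducedWindowBound
import HarnessLib

/-!
# Sparse certificate replay, part 5c: the assembled bound with ONE aggregated INEQUALITY row (class-LIMIT groundwork)

Cell `ym-instrument` (HOME `run/shared/lean/pub/ym-instrument/`), crew (a), seat `ym-instrument-boot-lean-1` (gen 3); groundwork for the
planner proposal P-A5 «class-LIMIT kernel replay» (desk `LIMIT-BIND-SCOPE.md`): the class-LIMIT certificate files carry, besides the
3 300 equality rows, 9 INEQUALITY rows (`hd`/`hk`/mono objects) with dual multipliers `κ_i ≥ 0`. Aggregating the equality rows with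
their multipliers `λ_e` AND the inequality rows with `κ_i` gives ONE row `a` of which only `Σ_e λ_e rhs_e − Σ_i κ_i u_i ≤ a · y` is
known; `objective_bound_win_of_le` is the sibling of `Sparse.objective_bound_win` (SparseReducedWindowBound) for that one-sided row —
SAME data (`cZ`, `RN`, `rhsN`, `GB`, `EB`, `dimL`), SAME kernel checks (`WinOK`, `finalCheckW`, `lenCheckAll`, `dimCheck`), so an emitted
certificate module differs from the equality case only in the hypothesis it exposes. Generic; [folklore]; nothing here is specific to
lattice gauge theory.

HONEST FRAMING (cells `pub-gaugeboot` / `ym-instrument`): certified bounds on lattice expectations at stated coupling, gauge group,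
dimension and torus size; NOT a mass gap, NOT a continuum limit, NOT a string tension; NOT Yang–Mills-summit-bearing (barriers
`FixedCouplingUltralocality`, `PerturbativeInvisibility`). This module certifies nothing by itself.
-/

namespace Summit.QuantumFields.GaugeBoot.Certificates.Sparse

open Matrix Finset Literature.Computation.Certificates

noncomputable section

/-- **Certified lower bound on the objective — reduced blocks, windowed residuals, ONE aggregated INEQUALITY row.**
For integer objective coefficients `c_v = coef cZ v`, ONE aggregated row known only as a LOWER BOUND `rhs_N / D ≤ Σ_v (n_v / D) y_v`
(`n_v = RN[v]`), Gram duals from the factor rows `GB` (`lenCheckAll`), reduced entry tables `EB` (`dimCheck`),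
the window statement `WinOK … 0 (nv+1) S` and the scalar check `finalCheckW rhsN S D K lower`: every real `y`
with `y_0 = 1`, `|y_v| ≤ 1`, the aggregated INEQUALITY and all reduced blocks PSD satisfies `lower ≤ c · y` — the SAME tables and
kernel checks as `objective_bound_win` (an equality aggregate of multipliers `λ_e` plus inequality rows `row_i · y ≤ u_i` with
multipliers `κ_i ≥ 0` aggregates to exactly such a one-sided row). (Proof: `JanssonChaykinKeil.lmiForm_bound` with its INEQUALITY slot,
`I := Fin 1`, `rowI = −a`, `upper = −rhs_N/D`, `κ = 1`, residuals `r_v = N_v / (D · 4^K)`.) [folklore] -/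
theorem objective_bound_win_of_le {nv nb m K D : ℕ} (cZ : List (ℕ × ℤ)) (RN : List ℤ) (rhsN : ℤ)
    (GB : List (List (List ℤ))) (EB : List (List (List (List (ℕ × ℤ))))) (dimL : List ℕ) (lower : ℚ) (S : ℤ)
    (hD : 0 < D)
    (hwin : WinOK GB EB nb m cZ RN ((4 : ℤ) ^ K) (D : ℤ) 0 (nv + 1) S)
    (hfin : finalCheckW rhsN S D K lower = true)
    (hlen : lenCheckAll GB m nb = true) (hdim : dimCheck EB dimL m nb = true)
    {y : Fin (nv + 1) → ℝ} (hy0 : y 0 = 1) (hρ : ∀ v : Fin (nv + 1), v ≠ 0 → |y v| ≤ 1)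
    (hagg : (rhsN : ℝ) / (D : ℝ) ≤ ∑ v : Fin (nv + 1), ((RN.getD v.val 0 : ℤ) : ℝ) / (D : ℝ) * y v)
    (hpsd : ∀ k : Fin nb, (redE EB k.val (dimL.getD k.val 0) (nv + 1) y).PosSemidef) :
    ((lower : ℚ) : ℝ) ≤ ∑ v : Fin (nv + 1), ((coef cZ v.val : ℤ) : ℝ) * y v := by
  have hD' : (0 : ℝ) < D := by exact_mod_cast hD
  have hDne : (D : ℝ) ≠ 0 := ne_of_gt hD'
  have hP : (0 : ℝ) < 4 ^ K := by positivity
  have hDP : (0 : ℝ) < (D : ℝ) * 4 ^ K := mul_pos hD' hP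
  -- residuals `r_v = N_v / (D · 4^K)` as a function on ℕ
  have hineq : ∀ i : Fin 1, ∑ v : Fin (nv + 1), (-(((RN.getD v.val 0 : ℤ) : ℝ) / (D : ℝ))) * y v ≤ -((rhsN : ℝ) / (D : ℝ)) :=
    fun _ => by
      have e : ∑ v : Fin (nv + 1), (-(((RN.getD v.val 0 : ℤ) : ℝ) / (D : ℝ))) * y v =
          -(∑ v : Fin (nv + 1), ((RN.getD v.val 0 : ℤ) : ℝ) / (D : ℝ) * y v) := by
        rw [← Finset.sum_neg_distrib]; exact Finset.sum_congr rfl fun v _ => by ring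
      rw [e]; exact neg_le_neg hagg
  have h := JanssonChaykinKeil.lmiForm_bound (V := Fin (nv + 1)) (E := Fin 0) (I := Fin 1)
    (K := Fin nb) (σ := fun _ => Fin m)
    (fun v => ((coef cZ v.val : ℤ) : ℝ)) 0 0
    (fun i => Fin.elim0 i) (fun i => Fin.elim0 i)
    (fun _ v => -(((RN.getD v.val 0 : ℤ) : ℝ) / (D : ℝ))) (fun _ => -((rhsN : ℝ) / (D : ℝ)))
    (fun _ => 0) (fun k v => (fzE EB k.val m v.val).map (Int.cast : ℤ → ℝ)) (fun _ => 1)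
    (fun k => trace (∑ v, y v • (fzE EB k.val m v.val).map (Int.cast : ℤ → ℝ)))
    (y := y) hy0 hρ (fun i => Fin.elim0 i) hineq
    (fun k => by rw [zero_add]; exact posSemidef_gramE_of_redE hdim k.isLt (hpsd k)) (fun k => by simp)
    (fun i => Fin.elim0 i) (fun _ => 1) (fun _ => zero_le_one)
    (fun k => zr (GB.getD k.val []) m K) (fun _ => 0)
    (fun k => by simpa using zr_posSemidef K (lenCheck_of_all hlen k))
    (fun v => ((resN GB EB nb m cZ RN ((4 : ℤ) ^ K) (D : ℤ) v.val : ℤ) : ℝ) / ((D : ℝ) * 4 ^ K))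
    (fun v => by
      simp only [Finset.univ_unique, Fin.default_eq_zero, Finset.sum_singleton, one_mul,
        Finset.univ_eq_empty, Finset.sum_empty]
      rw [sum_trace_zr_mul_fzE_eq_trZ GB EB nb m K v, resN]
      push_cast
      field_simp; ring)
    (((resN GB EB nb m cZ RN ((4 : ℤ) ^ K) (D : ℤ) 0 : ℤ) : ℝ) / ((D : ℝ) * 4 ^ K) + (rhsN : ℝ) / (D : ℝ))
    (by simp)
  -- simplify the JCK conclusion
  simp only [min_self, abs_zero, zero_mul, Finset.sum_const_zero, sub_zero, add_zero, mul_one] at h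
  -- the window statement
  obtain ⟨_, hS⟩ := hwin
  rw [Nat.sub_zero, Finset.sum_range_succ'] at hS
  simp only [zero_add, gSpec, Nat.add_one_ne_zero, if_false, if_true] at hS
  -- the final check, cast to ℝ
  have hfin' : ((lower : ℚ) : ℝ) ≤ (((rhsN * 4 ^ K - S : ℤ) : ℚ) : ℝ) / ((D : ℝ) * 4 ^ K) := by
    rw [finalCheckW, decide_eq_true_eq] at hfin
    have := (Rat.cast_le (K := ℝ)).mpr hfin
    push_cast at this ⊢
    exact this
  -- Σ_{v ≠ 0} |r v| as a range sum over ℕ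
  have herase : ∑ v ∈ Finset.univ.erase (0 : Fin (nv + 1)),
      |((resN GB EB nb m cZ RN ((4 : ℤ) ^ K) (D : ℤ) v.val : ℤ) : ℝ) / ((D : ℝ) * 4 ^ K)| =
      ∑ i ∈ Finset.range nv, |((resN GB EB nb m cZ RN ((4 : ℤ) ^ K) (D : ℤ) (i + 1) : ℤ) : ℝ) / ((D : ℝ) * 4 ^ K)| := by
    have h1 := Finset.add_sum_erase (Finset.univ : Finset (Fin (nv + 1)))
      (fun v => |((resN GB EB nb m cZ RN ((4 : ℤ) ^ K) (D : ℤ) v.val : ℤ) : ℝ) / ((D : ℝ) * 4 ^ K)|)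
      (Finset.mem_univ 0)
    rw [Fin.sum_univ_succ] at h1
    have h2 := add_left_cancel h1
    rw [h2, ← Fin.sum_univ_eq_sum_range]
    rfl
  rw [herase] at h
  refine le_trans hfin' (le_trans (le_of_eq ?_) h)
  -- the identity (rhsN·4^K − S)/(D·4^K) = r 0 + rhsN/D − Σ |r (i+1)|
  have habs : ∀ i ∈ Finset.range nv,
      |((resN GB EB nb m cZ RN ((4 : ℤ) ^ K) (D : ℤ) (i + 1) : ℤ) : ℝ) / ((D : ℝ) * 4 ^ K)| =
      |((resN GB EB nb m cZ RN ((4 : ℤ) ^ K) (D : ℤ) (i + 1) : ℤ) : ℝ)| / ((D : ℝ) * 4 ^ K) := by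
    intro i _
    rw [abs_div, abs_of_pos hDP]
  rw [Finset.sum_congr rfl habs, ← Finset.sum_div, hS]
  push_cast
  field_simp
  ring

/-- The equality case is a special case (sanity link to `objective_bound_win`'s hypotheses). [folklore] -/
theorem objective_bound_win_of_le_of_eq {nv nb m K D : ℕ} (cZ : List (ℕ × ℤ)) (RN : List ℤ) (rhsN : ℤ)
    (GB : List (List (List ℤ))) (EB : List (List (List (List (ℕ × ℤ))))) (dimL : List ℕ) (lower : ℚ) (S : ℤ)
    (hD : 0 < D)
    (hwin : WinOK GB EB nb m cZ RN ((4 : ℤ) ^ K) (D : ℤ) 0 (nv + 1) S)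
    (hfin : finalCheckW rhsN S D K lower = true)
    (hlen : lenCheckAll GB m nb = true) (hdim : dimCheck EB dimL m nb = true)
    {y : Fin (nv + 1) → ℝ} (hy0 : y 0 = 1) (hρ : ∀ v : Fin (nv + 1), v ≠ 0 → |y v| ≤ 1)
    (hagg : ∑ v : Fin (nv + 1), ((RN.getD v.val 0 : ℤ) : ℝ) / (D : ℝ) * y v = (rhsN : ℝ) / (D : ℝ))
    (hpsd : ∀ k : Fin nb, (redE EB k.val (dimL.getD k.val 0) (nv + 1) y).PosSemidef) :
    ((lower : ℚ) : ℝ) ≤ ∑ v : Fin (nv + 1), ((coef cZ v.val : ℤ) : ℝ) * y v :=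
  objective_bound_win_of_le cZ RN rhsN GB EB dimL lower S hD hwin hfin hlen hdim hy0 hρ hagg.symm.le hpsd

end

end Summit.QuantumFields.GaugeBoot.Certificates.Sparse
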